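import Summits.CriticalPhenomena.PercolationContinuityZ3.Theses.PercMonotoneFactors
import Literature.Probability.Percolation.SharpnessDCTProofs
import HarnessLib

/-!
# Crux `MesoscopicDensity` (stmt-CriticalPhenomena-18049) — birth skeleton (BC3)

Line `birth`: MESOSCOPIC DENSITY from a quantitative BOX-HITTING BOUND.  With `m = ⌊√n⌋+1` and
`k = ⌊m/2⌋`, the density event `D_n` fails only if, for some `v ∈ Λ_{2n}`, the half-size box
`Λ_k(w)`, `w = v` clamped into `Λ_{2n-k}` (so that `Λ_k(w) ⊆ Λ_m(v) ∩ Λ_{2n}`), contains NO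
`n`-far-connected point.  Two stubs:

* `stub_boxHitRate` (the heart; open at a percolating threshold even for `F = id`): wherever a class
  member percolates, the box `Λ_k(0)` misses every `n`-far-connected point with probability
  `≤ C n⁻⁴` (quantitative relative density of the large clusters at scale `√n`);
* `stub_shiftInvariance` (provable now, M): translation covariance of `μ_t^F` and of the hole event.

Composition `MesoscopicDensity_of` (proved here): clamping geometry, union bound over the `(4n+1)³`
points of `Λ_{2n}`, `(4n+1)³ C n⁻⁴ ≤ 125 C / n → 0`, locality (measurability) of `D_n`, squeeze.
-/

noncomputable section

namespace Summit.CriticalPhenomena.PercolationContinuityZ3.Cruxes.MesoscopicDensity.Birth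

open MeasureTheory Filter Topology Set
open Literature.Probability.Percolation Literature.Probability.LatticeModels
open Summit.CriticalPhenomena.PercolationContinuityZ3.Theses.PercMonotoneFactors

/-! ### Stubs -/

/-- STUB (rank 1, the heart of the line): **box-hitting bound with a polynomial rate.** Wherever an
admissible `F` percolates at `t`, the probability that the box `Λ_k(0)`, `k = ⌊(⌊√n⌋+1)/2⌋`,
contains no `n`-far-connected point is `≤ C n⁻⁴`.  Supercritical `F = id`: `exp(-c k)`
(the infinite cluster meets every mesoscopic box, Grimmett–Marstrand).  At a percolating
threshold: open (needs a rate for the one-arm of finite clusters). -/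
theorem stub_boxHitRate :
    ∀ (R : ℕ) (F : BondConfig (Site 3) → BondConfig (Site 3)), Measurable F → Monotone F → F ∅ = ∅ → F (zdGraph 3).edgeSet = (zdGraph 3).edgeSet → (∀ ω : BondConfig (Site 3), ω ⊆ (zdGraph 3).edgeSet → F ω ⊆ (zdGraph 3).edgeSet) → (∀ (φ : zdGraph 3 ≃g zdGraph 3) (ω : BondConfig (Site 3)), F (Sym2.map φ '' ω) = Sym2.map φ '' (F ω)) → (∀ (ω ω' : BondConfig (Site 3)) (e : Sym2 (Site 3)), (∀ e' : Sym2 (Site 3), (∃ x ∈ e, ∃ y ∈ e', ∀ i, |x i - y i| ≤ (R : ℤ)) → (e' ∈ ω ↔ e' ∈ ω')) → (e ∈ F ω ↔ e ∈ F ω')) → ∀ t : unitInterval, 0 < ((bondPercolation (zdGraph 3) t).map F).real (percolatesAt 0) → ∃ C : ℝ, ∀ n : ℕ, 1 ≤ n → ((bondPercolation (zdGraph 3) t).map F).real {ω : BondConfig (Site 3) | ¬ ∃ u : Site 3, (∀ i, |u i - (0 : Site 3) i| ≤ (((Nat.sqrt n + 1) / 2 : ℕ) : ℤ)) ∧ (∃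 y : Site 3, (∃ i, |y i - u i| = (n : ℤ)) ∧ ω ∈ openConnIn {z : Site 3 | ∀ i, |z i - u i| ≤ (n : ℤ)} u y)} ≤ C / (n : ℝ) ^ 4 := by
  sorry

/-- STUB (rank 2, provable now): **translation covariance** of the block-factor law and of the
hole event: the hole probability around `w` equals the one around the origin. -/
theorem stub_shiftInvariance :
    ∀ (R : ℕ) (F : BondConfig (Site 3) → BondConfig (Site 3)), Measurable F → Monotone F → F ∅ = ∅ → F (zdGraph 3).edgeSet = (zdGraph 3).edgeSet → (∀ ω : BondConfig (Site 3), ω ⊆ (zdGraph 3).edgeSet → F ω ⊆ (zdGraph 3).edgeSet) → (∀ (φ : zdGraph 3 ≃g zdGraph 3) (ω : BondConfig (Site 3)), F (Sym2.map φ '' ω) = Sym2.map φ '' (F ω)) → (∀ (ω ω' : BondConfig (Site 3)) (e : Sym2 (Site 3)), (∀ e' : Sym2 (Site 3), (∃ x ∈ e, ∃ y ∈ e', ∀ i, |x i - y i| ≤ (R : ℤ)) → (e' ∈ ω ↔ e' ∈ ω')) → (e ∈ F ω ↔ e ∈ F ω')) → ∀ t : unitInterval, ∀ (n : ℕ) (w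 : Site 3), ((bondPercolation (zdGraph 3) t).map F).real {ω : BondConfig (Site 3) | ¬ ∃ u : Site 3, (∀ i, |u i - w i| ≤ (((Nat.sqrt n + 1) / 2 : ℕ) : ℤ)) ∧ (∃ y : Site 3, (∃ i, |y i - u i| = (n : ℤ)) ∧ ω ∈ openConnIn {z : Site 3 | ∀ i, |z i - u i| ≤ (n : ℤ)} u y)} = ((bondPercolation (zdGraph 3) t).map F).real {ω : BondConfig (Site 3) | ¬ ∃ u : Site 3, (∀ i, |u i - (0 : Site 3) i| ≤ (((Nat.sqrt n + 1) / 2 : ℕ) : ℤ)) ∧ (∃ y : Site 3, (∃ i, |y i - u i| = (n : ℤ)) ∧ ω ∈ openConnIn {z : Site 3 | ∀ i, |z i - u i| ≤ (n : ℤ)} u y)} := by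
  sorry

/-! ### Tools for the composition -/

/-- The cube `Λ_m` of `ℤ³` is finite. [folklore] -/
theorem finite_cube (m : ℤ) : {z : Site 3 | ∀ i, |z i| ≤ m}.Finite :=
  (Set.finite_Icc (fun _ => -m) (fun _ => m)).subset fun z (hz : ∀ i, |z i| ≤ m) =>
    ⟨fun i => (abs_le.1 (hz i)).1, fun i => (abs_le.1 (hz i)).2⟩

/-- The density event `D_n` is determined by the pairs of `Λ_{3n}` (local event). [folklore] -/
theorem determinedBy_densityEvent (n : ℕ) :
    DeterminedBy {ω : BondConfig (Site 3) | ∀ v : Site 3, (∀ i, |v i| ≤ 2 * (n : ℤ)) → ∃ u : Site 3, (∀ i, |u i - v i| ≤ ((Nat.sqrt n + 1 : ℕ) : ℤ)) ∧ (∀ i, |u i| ≤ 2 * (n : ℤ)) ∧ (∃ y : Site 3, (∃ i, |y i - u i| = (n : ℤ)) ∧ ω ∈ openConnIn {z : Site 3 | ∀ i, |z i - u i| ≤ (n : ℤ)} u y)}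
      {z : Site 3 | ∀ i, |z i| ≤ 3 * (n : ℤ)}.sym2 := by
  rw [determinedBy_iff]
  intro ω ω' h
  have hsub : ∀ u : Site 3, (∀ i, |u i| ≤ 2 * (n : ℤ)) →
      {z : Site 3 | ∀ i, |z i - u i| ≤ (n : ℤ)}.sym2 ⊆ {z : Site 3 | ∀ i, |z i| ≤ 3 * (n : ℤ)}.sym2 := by
    intro u hu e he
    rw [Set.mem_sym2_iff_subset] at he ⊢
    intro z hz
    have h1 : ∀ i, |z i - u i| ≤ (n : ℤ) := he hz
    show ∀ i, |z i| ≤ 3 * (n : ℤ)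
    intro i
    have h1 := h1 i
    have h2 := hu i
    have hn0 : (0 : ℤ) ≤ n := Int.natCast_nonneg n
    rw [abs_le] at h1 h2 ⊢
    constructor <;> linarith [h1.1, h1.2, h2.1, h2.2]
  have hiff : ∀ u : Site 3, (∀ i, |u i| ≤ 2 * (n : ℤ)) → ∀ y : Site 3,
      (ω ∈ openConnIn {z : Site 3 | ∀ i, |z i - u i| ≤ (n : ℤ)} u y ↔
        ω' ∈ openConnIn {z : Site 3 | ∀ i, |z i - u i| ≤ (n : ℤ)} u y) :=
    fun u hu y => (determinedBy_iff _ _).1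
      (DCT16.determinedBy_openConnIn _ u y (hsub u hu)) ω ω' h
  simp only [Set.mem_setOf_eq]
  refine forall_congr' fun v => imp_congr_right fun hv => exists_congr fun u => ?_
  constructor
  · rintro ⟨h1, h2, h3⟩
    exact ⟨h1, h2, (exists_congr fun y => and_congr_right fun _ => hiff u h2 y).1 h3⟩
  · rintro ⟨h1, h2, h3⟩
    exact ⟨h1, h2, (exists_congr fun y => and_congr_right fun _ => hiff u h2 y).2 h3⟩

/-- `D_n` is measurable. [folklore] -/
theorem measurableSet_densityEvent (n : ℕ) :
    MeasurableSet {ω : BondConfig (Site 3) | ∀ v : Site 3, (∀ i, |v i| ≤ 2 * (n : ℤ)) → ∃ u : Site 3, (∀ i, |u i - v i| ≤ ((Nat.sqrt n + 1 : ℕ) : ℤ)) ∧ (∀ i, |u i| ≤ 2 * (n : ℤ)) ∧ (∃ y : Site 3, (∃ i, |y i - u i| = (n : ℤ)) ∧ ω ∈ openConnIn {z : Site 3 | ∀ i, |z i - u i| ≤ (n : ℤ)} u y)} := by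
  classical
  have hSfin : ({z : Site 3 | ∀ i, |z i| ≤ 3 * (n : ℤ)}).Finite := finite_cube _
  have h' : DeterminedBy {ω : BondConfig (Site 3) | ∀ v : Site 3, (∀ i, |v i| ≤ 2 * (n : ℤ)) → ∃ u : Site 3, (∀ i, |u i - v i| ≤ ((Nat.sqrt n + 1 : ℕ) : ℤ)) ∧ (∀ i, |u i| ≤ 2 * (n : ℤ)) ∧ (∃ y : Site 3, (∃ i, |y i - u i| = (n : ℤ)) ∧ ω ∈ openConnIn {z : Site 3 | ∀ i, |z i - u i| ≤ (n : ℤ)} u y)} ↑(hSfin.toFinset.sym2) := by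
    rw [Finset.coe_sym2, hSfin.coe_toFinset]
    exact determinedBy_densityEvent n
  exact h'.measurableSet_of_finset

/-- The number of lattice points of `Λ_{2n}` is `(4n+1)³`. [folklore] -/
theorem card_box (n : ℕ) :
    ((Finset.Icc (fun _ : Fin 3 => -(2 * (n : ℤ))) (fun _ => 2 * (n : ℤ))).card : ℝ) =
      ((4 * n + 1 : ℕ) : ℝ) ^ 3 := by
  rw [Pi.card_Icc]
  simp only [Int.card_Icc, Finset.prod_const, Finset.card_univ, Fintype.card_fin]
  have : (2 * (n : ℤ) + 1 - -(2 * (n : ℤ))).toNat = 4 * n + 1 := by omega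
  rw [this]
  push_cast
  ring

/-- **Union bound** (abstract). [folklore] -/
theorem measureReal_le_card_mul {X ι : Type*} [MeasurableSpace X] (μ : Measure X) [IsFiniteMeasure μ]
    (s : Finset ι) (T : ι → Set X) (A : Set X) (h : A ⊆ ⋃ u ∈ s, T u) (c : ℝ)
    (hT : ∀ u ∈ s, μ.real (T u) ≤ c) : μ.real A ≤ (s.card : ℝ) * c := by
  calc μ.real A ≤ μ.real (⋃ u ∈ s, T u) := measureReal_mono h (measure_ne_top μ _)
    _ ≤ ∑ u ∈ s, μ.real (T u) := measureReal_biUnion_finset_le _ _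
    _ ≤ ∑ _u ∈ s, c := Finset.sum_le_sum hT
    _ = (s.card : ℝ) * c := by rw [Finset.sum_const, nsmul_eq_mul]

/-- **Squeeze** (abstract). [folklore] -/
theorem tendsto_one_of_compl_le {X : Type*} [MeasurableSpace X] (μ : Measure X)
    [IsProbabilityMeasure μ] (G : ℕ → Set X) (hGm : ∀ n, MeasurableSet (G n)) (a : ℕ → ℝ)
    (ha : Tendsto a atTop (𝓝 0)) (h : ∀ᶠ n in atTop, μ.real (G n)ᶜ ≤ a n) :
    Tendsto (fun n => μ.real (G n)) atTop (𝓝 1) := by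
  have hlow : Tendsto (fun n => 1 - a n) atTop (𝓝 1) := by simpa using ha.const_sub 1
  refine tendsto_of_tendsto_of_tendsto_of_le_of_le' hlow tendsto_const_nhds ?_
    (Eventually.of_forall fun n => measureReal_le_one)
  filter_upwards [h] with n hn
  have hcompl := measureReal_compl (μ := μ) (hGm n)
  rw [probReal_univ] at hcompl
  linarith

/-- `(4n+1)³ · C n⁻⁴ ≤ 125 C / n` for `n ≥ 1`, `C ≥ 0`. [folklore] -/
theorem rate_bound {C : ℝ} (hC0 : 0 ≤ C) (n : ℕ) (hn : 1 ≤ n) :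
    ((4 * n + 1 : ℕ) : ℝ) ^ 3 * (C / (n : ℝ) ^ 4) ≤ 125 * C / (n : ℝ) := by
  have hn' : (1 : ℝ) ≤ n := by exact_mod_cast hn
  have hnpos : (0 : ℝ) < n := by linarith
  have h45 : ((4 * n + 1 : ℕ) : ℝ) ^ 3 ≤ 125 * (n : ℝ) ^ 3 := by
    have : ((4 * n + 1 : ℕ) : ℝ) ≤ 5 * (n : ℝ) := by push_cast; linarith
    calc ((4 * n + 1 : ℕ) : ℝ) ^ 3 ≤ (5 * (n : ℝ)) ^ 3 := by gcongr
      _ = 125 * (n : ℝ) ^ 3 := by ring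
  calc ((4 * n + 1 : ℕ) : ℝ) ^ 3 * (C / (n : ℝ) ^ 4)
      ≤ 125 * (n : ℝ) ^ 3 * (C / (n : ℝ) ^ 4) := by gcongr
    _ = 125 * C / (n : ℝ) := by field_simp

/-- **Clamping** (one coordinate): for `|a| ≤ N` and `0 ≤ k ≤ N`, the clamp
`c = max(-(N-k), min(N-k, a))` satisfies `|c| ≤ N - k` and `|c - a| ≤ k`. [folklore] -/
theorem clamp_coord (a N k : ℤ) (ha : |a| ≤ N) (hk0 : 0 ≤ k) (hkN : k ≤ N) :
    |max (-(N - k)) (min (N - k) a)| ≤ N - k ∧ |max (-(N - k)) (min (N - k) a) - a| ≤ k := by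
  have h := abs_le.1 ha
  constructor
  · rw [abs_le]
    constructor
    · exact le_max_left _ _
    · exact max_le (by linarith) (min_le_left _ _)
  · rw [abs_le]
    rcases le_total (N - k) a with h1 | h1
    · rw [min_eq_left h1, max_eq_right (by linarith)]
      constructor <;> linarith
    · rw [min_eq_right h1]
      rcases le_total (-(N - k)) a with h2 | h2
      · rw [max_eq_right h2]; constructor <;> linarith
      · rw [max_eq_left h2]; constructor <;> linarith

/-- **Deterministic reduction**: a failure of the density event `D_n` at `v ∈ Λ_{2n}` is a hole of
the half-size box around the clamped centre (`Λ_k(w) ⊆ Λ_m(v) ∩ Λ_{2n}`). [folklore] -/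
theorem compl_density_subset (n : ℕ) (hn : 1 ≤ n) :
    {ω : BondConfig (Site 3) | ∀ v : Site 3, (∀ i, |v i| ≤ 2 * (n : ℤ)) → ∃ u : Site 3, (∀ i, |u i - v i| ≤ ((Nat.sqrt n + 1 : ℕ) : ℤ)) ∧ (∀ i, |u i| ≤ 2 * (n : ℤ)) ∧ (∃ y : Site 3, (∃ i, |y i - u i| = (n : ℤ)) ∧ ω ∈ openConnIn {z : Site 3 | ∀ i, |z i - u i| ≤ (n : ℤ)} u y)}ᶜ ⊆
      ⋃ v ∈ Finset.Icc (fun _ : Fin 3 => -(2 * (n : ℤ))) (fun _ => 2 * (n : ℤ)),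
        {ω : BondConfig (Site 3) | ¬ ∃ u : Site 3, (∀ i, |u i - (fun i => max (-(2 * (n : ℤ) - (((Nat.sqrt n + 1) / 2 : ℕ) : ℤ))) (min (2 * (n : ℤ) - (((Nat.sqrt n + 1) / 2 : ℕ) : ℤ)) (v i))) i| ≤ (((Nat.sqrt n + 1) / 2 : ℕ) : ℤ)) ∧ (∃ y : Site 3, (∃ i, |y i - u i| = (n : ℤ)) ∧ ω ∈ openConnIn {z : Site 3 | ∀ i, |z i - u i| ≤ (n : ℤ)} u y)} := by
  intro ω hω
  rw [Set.mem_compl_iff, Set.mem_setOf_eq] at hω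
  obtain ⟨v, hω⟩ := not_forall.1 hω
  obtain ⟨hv, hnot⟩ := Classical.not_imp.1 hω
  have hvb : v ∈ Finset.Icc (fun _ : Fin 3 => -(2 * (n : ℤ))) (fun _ => 2 * (n : ℤ)) := by
    rw [Finset.mem_Icc]
    exact ⟨fun i => (abs_le.1 (hv i)).1, fun i => (abs_le.1 (hv i)).2⟩
  refine Set.mem_iUnion₂.2 ⟨v, hvb, ?_⟩
  -- numerics of the scales: `0 ≤ k`, `2k ≤ m`, `k ≤ 2n`
  have hk0 : (0 : ℤ) ≤ (((Nat.sqrt n + 1) / 2 : ℕ) : ℤ) := Int.natCast_nonneg _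
  have h2k : 2 * (((Nat.sqrt n + 1) / 2 : ℕ) : ℤ) ≤ ((Nat.sqrt n + 1 : ℕ) : ℤ) := by
    have := Nat.mul_div_le (Nat.sqrt n + 1) 2
    push_cast
    omega
  have hkN : (((Nat.sqrt n + 1) / 2 : ℕ) : ℤ) ≤ 2 * (n : ℤ) := by
    have h1 : (Nat.sqrt n + 1) / 2 ≤ Nat.sqrt n + 1 := Nat.div_le_self _ _
    have h2 : Nat.sqrt n ≤ n := Nat.sqrt_le_self n
    push_cast
    omega
  rintro ⟨u, hu, hFu⟩
  apply hnot
  refine ⟨u, fun i => ?_, fun i => ?_, hFu⟩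
  · have hc := (clamp_coord (v i) (2 * (n : ℤ)) (((Nat.sqrt n + 1) / 2 : ℕ) : ℤ) (hv i) hk0 hkN).2
    have hui := hu i
    calc |u i - v i| ≤ |u i - max (-(2 * (n : ℤ) - (((Nat.sqrt n + 1) / 2 : ℕ) : ℤ))) (min (2 * (n : ℤ) - (((Nat.sqrt n + 1) / 2 : ℕ) : ℤ)) (v i))| +
          |max (-(2 * (n : ℤ) - (((Nat.sqrt n + 1) / 2 : ℕ) : ℤ))) (min (2 * (n : ℤ) - (((Nat.sqrt n + 1) / 2 : ℕ) : ℤ)) (v i)) - v i| := abs_sub_le _ _ _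
      _ ≤ (((Nat.sqrt n + 1) / 2 : ℕ) : ℤ) + (((Nat.sqrt n + 1) / 2 : ℕ) : ℤ) := add_le_add hui hc
      _ ≤ ((Nat.sqrt n + 1 : ℕ) : ℤ) := by linarith
  · have hc := (clamp_coord (v i) (2 * (n : ℤ)) (((Nat.sqrt n + 1) / 2 : ℕ) : ℤ) (hv i) hk0 hkN).1
    have hui := hu i
    calc |u i| = |(u i - max (-(2 * (n : ℤ) - (((Nat.sqrt n + 1) / 2 : ℕ) : ℤ))) (min (2 * (n : ℤ) - (((Nat.sqrt n + 1) / 2 : ℕ) : ℤ)) (v i))) +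
          max (-(2 * (n : ℤ) - (((Nat.sqrt n + 1) / 2 : ℕ) : ℤ))) (min (2 * (n : ℤ) - (((Nat.sqrt n + 1) / 2 : ℕ) : ℤ)) (v i))| := by ring_nf
      _ ≤ |u i - max (-(2 * (n : ℤ) - (((Nat.sqrt n + 1) / 2 : ℕ) : ℤ))) (min (2 * (n : ℤ) - (((Nat.sqrt n + 1) / 2 : ℕ) : ℤ)) (v i))| +
          |max (-(2 * (n : ℤ) - (((Nat.sqrt n + 1) / 2 : ℕ) : ℤ))) (min (2 * (n : ℤ) - (((Nat.sqrt n + 1) / 2 : ℕ) : ℤ)) (v i))| := abs_add_le _ _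
      _ ≤ (((Nat.sqrt n + 1) / 2 : ℕ) : ℤ) + (2 * (n : ℤ) - (((Nat.sqrt n + 1) / 2 : ℕ) : ℤ)) := add_le_add hui hc
      _ = 2 * (n : ℤ) := by ring

/-! ### Composition -/

/-- **`MesoscopicDensity` from the two stubs**: clamping, union bound over `Λ_{2n}`, shift
invariance, `(4n+1)³ · C n⁻⁴ ≤ 125 C / n → 0`, and `μ(D_n) = 1 - μ(D_nᶜ)` (`D_n` is local). -/
theorem MesoscopicDensity_of : MesoscopicDensity := by
  intro R F hFm hFmono hF0 hFE hFsub hFeq hloc t hpos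
  obtain ⟨C, hC⟩ := stub_boxHitRate R F hFm hFmono hF0 hFE hFsub hFeq hloc t hpos
  have hshift := stub_shiftInvariance R F hFm hFmono hF0 hFE hFsub hFeq hloc t
  haveI : IsProbabilityMeasure ((bondPercolation (zdGraph 3) t).map F) :=
    Measure.isProbabilityMeasure_map hFm.aemeasurable
  have hC0 : 0 ≤ C := by
    have := hC 1 le_rfl
    simp only [Nat.cast_one, one_pow, div_one] at this
    exact measureReal_nonneg.trans this
  refine tendsto_one_of_compl_le ((bondPercolation (zdGraph 3) t).map F) _
    (fun n => measurableSet_densityEvent n) (fun n => 125 * C / (n : ℝ))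
    (tendsto_const_div_atTop_nhds_zero_nat (125 * C)) ?_
  filter_upwards [eventually_ge_atTop 1] with n hn
  refine ((measureReal_le_card_mul ((bondPercolation (zdGraph 3) t).map F) _ _ _
    (compl_density_subset n hn) (C / (n : ℝ) ^ 4) fun v _ => (hshift n _).le.trans (hC n hn)).trans ?_)
  rw [card_box n]
  exact rate_bound hC0 n hn

end Summit.CriticalPhenomena.PercolationContinuityZ3.Cruxes.MesoscopicDensity.Birth
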